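import Summits.ValiantsHypothesis.ValiantsHypothesis.Theorems.LacunarySymmetroidMatrixDescartesPivotBilinearAllLetters
import Summits.ValiantsHypothesis.ValiantsHypothesis.Theorems.LacunarySymmetroidMatrixDescartesCensusPivotBridge

/-!
# `MatrixDescartes` (stmt-ValiantsHypothesis-18050) — THE BILINEAR BUDGET IS ATTAINED AT EVERY FORMAT:
# `Z₊ ≥ 2(m−1)(K−1) + 2` for index-one pivot pencils of every size `m ≥ 1` and every `K ≥ 2`

HONEST FRAMING.  Cell `pub-symmetroid`, seat `val-sym-mdr-p2` (gen 24); helper file `--supports` the crux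
`Theses.LacunarySymmetroid.MatrixDescartes` (OPEN), NO closure claim.  Currency: conjb-1's pivot column (`…CensusPivotDefs`).
The typed bilinear guess R1‴ `RankOnePivotLawBilinear` («index `1 ⇒ Z₊ ≤ 2(m−1)(K−1) + 2`», OPEN) had its budget ATTAINED in
the kernel along the columns `K ≤ 6` (every `m`: arrowheads / balanced blocks, seat g8–g9) and along the row `m = 2` (every `K`:
pole weaving, `…PivotStaircaseAllK`).  This file attains it EVERYWHERE:
**`not_pivotRootLawAt_bilinear : ∀ m ≥ 1, ∀ K ≥ 2, ¬ PivotRootLawAt m K 1 (2(m−1)(K−1) + 1)`**, i.e. some index-one pivot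
pencil of format `(m, K)` has `≥ 2(m−1)(K−1) + 2` distinct positive determinant roots; hence
**`le_of_pivotRootLawAt_indexOne`** (every valid index-one row has budget `≥ 2(m−1)(K−1) + 2`) and
**`pivotRootLawAt_iff_of_bilinear`** (if R1‴ holds it is EXACT at every `(m, K)`, `m ≥ 1`, `K ≥ 2`); by zero padding the same
failure at every index `q ≥ 1` (`not_pivotRootLawAt_bilinear_index`).  So no index-one law strictly below the bilinear budget
survives anywhere, and R1‴ — if true — is the exact index-one law.  Nothing here asserts R1‴ or any upper bound; nothing
bears on `MatrixDescartes` in its window, on `DoorA26`/`DoorA34`, on the registers, or on `VP ≠ VNP`.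

THE OBJECT (stacked pole weaving, `m = k + 1`, `K = c + 1`): hub + `k` block coordinates; pivot `J = diag(1/8,…,1/8, −1 − k/2)`
at exponent `1`; letters at exponents `0, n₀, …, n_{c−1}` (`nᵢ = (S²)^{i+1}`, `S = 2^{c+7}`), arrowhead-shaped with block entries
`(q/2)Ξᵢ/Ξᵢ^d`, borders `±qΞᵢ/Ξᵢ^d`, corners `Σ 2qΞᵢ/Ξᵢ^d (+1, +s)` (`…PivotBilinearAllLetters`); determinant
`(∏(Ξᵢ/2)m(x/Ξᵢ))·x·(M(x) + s x^{n_{c−1}−1})` with the stacked model `M(x) = x⁻¹ − 1 + Σᵢ 2φ(x/Ξᵢ)` of `…PivotBilinearAllModel`,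
whose `2ck + 3` alternating points (scales `Ξᵢ` separated by the soft induction, `2c` pole-weaving crossings per block, one from
`M → −1`, one from the slack) give `2ck + 2 = 2(m−1)(K−1) + 2` roots by the intermediate value theorem.

[folklore] Assembly over Mathlib of the two companions; tree inputs `SymmetroidDescartes.le_card_posRoots_of_alternating`,
`Pivot.pivotRootLawAt_mono`, `Pivot.pivotRootLawAt_of_le_index`.
-/

set_option linter.dupNamespace false

namespace Summit.ValiantsHypothesis.ValiantsHypothesis.Theorems.LacunarySymmetroidMatrixDescartes.Pivot

open scoped BigOperators Matrix
open Finset Matrix Polynomial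

namespace PoleWeave

/-! ### Notation (as in the companions; local, no definitions) -/

/-- `S = 2^{c+7}`. -/
local notation3 (prettyPrint := false) "S⟦" c "⟧" => (2 ^ (c + 7))
/-- `nᵢ = (S²)^{i+1}`. -/
local notation3 (prettyPrint := false) "n⟦" c ", " i "⟧" => ((S⟦c⟧ * S⟦c⟧) ^ (i + 1))
/-- `Ã(y)`. -/
local notation3 (prettyPrint := false) "Ã⟦" c "⟧(" y ")" =>
  (∑ i : Fin c, (8 * (n⟦c, (i : ℕ)⟧ : ℝ)) * (y : ℝ) ^ (n⟦c, (i : ℕ)⟧ - 1))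
/-- `m(y)`. -/
local notation3 (prettyPrint := false) "m⟦" c "⟧(" y ")" => ((1 : ℝ) / 8 + (y : ℝ) / 4 + (y : ℝ) * Ã⟦c⟧(y))
/-- `φ(y)`. -/
local notation3 (prettyPrint := false) "φ⟦" c "⟧(" y ")" => ((Ã⟦c⟧(y) / 2 - (y : ℝ) / 16) / m⟦c⟧(y))
/-- The stacked model `M`. -/
local notation3 (prettyPrint := false) "M⟦" c ", " Ξ "⟧(" x ")" =>
  ((x : ℝ)⁻¹ - 1 + ∑ i, 2 * φ⟦c⟧((x : ℝ) / (Ξ : Fin _ → ℝ) i))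
/-- Coefficients. -/
local notation3 (prettyPrint := false) "qw⟦" c "⟧" =>
  (Fin.cons ((1 : ℝ) / 8) (fun l : Fin c => (8 * (n⟦c, (l : ℕ)⟧ : ℝ))) : Fin (c + 1) → ℝ)
/-- Exponents. -/
local notation3 (prettyPrint := false) "dw⟦" c "⟧" =>
  (Fin.cons 0 (fun l : Fin c => n⟦c, (l : ℕ)⟧) : Fin (c + 1) → ℕ)
/-- Border signs. -/
local notation3 (prettyPrint := false) "σw⟦" c "⟧" =>
  (Fin.cons (1 : ℝ) (fun _ : Fin c => (-1 : ℝ)) : Fin (c + 1) → ℝ)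
/-- Corner extras. -/
local notation3 (prettyPrint := false) "ew⟦" c ", " s "⟧" =>
  (Fin.cons (1 : ℝ) (fun l : Fin c => if (l : ℕ) + 1 = c then (s : ℝ) else 0) : Fin (c + 1) → ℝ)
/-- Reindexing. -/
local notation3 (prettyPrint := false) "rx[" A "]" => Matrix.reindex finSumFinEquiv finSumFinEquiv A
/-- The letters. -/
local notation3 (prettyPrint := false) "Lw⟦" c ", " Ξ ", " s "⟧(" l ")" =>
  (Matrix.fromBlocks (diagonal fun i : Fin _ => qw⟦c⟧ l / 2 * ((Ξ : Fin _ → ℝ) i / (Ξ : Fin _ → ℝ) i ^ (dw⟦c⟧ l)))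
    (Matrix.of fun (i : Fin _) (_ : Fin 1) => σw⟦c⟧ l * qw⟦c⟧ l * ((Ξ : Fin _ → ℝ) i / (Ξ : Fin _ → ℝ) i ^ (dw⟦c⟧ l)))
    (Matrix.of fun (_ : Fin 1) (i : Fin _) => σw⟦c⟧ l * qw⟦c⟧ l * ((Ξ : Fin _ → ℝ) i / (Ξ : Fin _ → ℝ) i ^ (dw⟦c⟧ l)))
    (Matrix.of fun (_ _ : Fin 1) => (∑ i, 2 * qw⟦c⟧ l * ((Ξ : Fin _ → ℝ) i / (Ξ : Fin _ → ℝ) i ^ (dw⟦c⟧ l))) + ew⟦c, s⟧ l))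
/-- The pivot. -/
local notation3 (prettyPrint := false) "Jw⟦" k "⟧" =>
  (Matrix.fromBlocks (diagonal fun _ : Fin k => (1 : ℝ) / 8) 0 0 (Matrix.of fun (_ _ : Fin 1) => -1 - (k : ℝ) / 2))

/-- Sign bookkeeping: consecutive terms of an alternating list have a negative product. -/
theorem mul_neg_of_alt {a b : ℝ} {j : ℕ} (ha : 0 < (-1 : ℝ) ^ j * a) (hb : 0 < (-1 : ℝ) ^ (j + 1) * b) :
    a * b < 0 := by
  rcases neg_one_pow_eq_or ℝ j with h | h
  · rw [pow_succ, h] at hb; rw [h] at ha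
    have hb' : b < 0 := by linarith
    exact mul_neg_of_pos_of_neg (by linarith) hb'
  · rw [pow_succ, h] at hb; rw [h] at ha
    have ha' : a < 0 := by linarith
    exact mul_neg_of_neg_of_pos ha' (by linarith)

/-- **The stacked pole-weaving pencil has `≥ 2ck + 2` positive roots** (`c ≥ 1`), for suitable scales `Ξ` and slack
`s ≥ 0`. -/
theorem exists_stacked (c k : ℕ) (hc : 1 ≤ c) :
    ∃ (Ξ : Fin k → ℝ) (s : ℝ), (∀ i, 0 < Ξ i) ∧ 0 ≤ s ∧
      2 * c * k + 2 ≤ pivotPosRoots 1 (dw⟦c⟧) (rx[Jw⟦k⟧]) (fun l => rx[Lw⟦c, Ξ, s⟧(l)]) := by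
  obtain ⟨Ξ, t, hΞ, hpos, hmono, hsign⟩ := model_alternates c hc k
  have hT : 1 ≤ n⟦c, c - 1⟧ - 1 := by
    have := S_le_n c (c - 1); have := S_ge c; omega
  obtain ⟨s, u, hs, hupos, humono, husign⟩ := end_step c hc (n⟦c, c - 1⟧ - 1) hT Ξ hΞ t hpos hmono hsign
  refine ⟨Ξ, s, hΞ, hs.le, ?_⟩
  unfold pivotPosRoots
  refine SymmetroidDescartes.le_card_posRoots_of_alternating _ (2 * c * k + 2)
    (fun j : Fin (2 * c * k + 2 + 1) => u j) (Fin.strictMono_iff_lt_succ.2 fun j => ?_) (fun j => hupos j (by omega))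
    fun j => ?_
  · simp only [Fin.val_castSucc, Fin.val_succ]
    exact humono j j.isLt
  · simp only [Fin.val_castSucc, Fin.val_succ]
    exact eval_mul_eval_neg c hc Ξ hΞ s (hupos j (by omega)) (hupos (j + 1) (by omega))
      (mul_neg_of_alt (husign j (by omega)) (husign (j + 1) (by omega)))

/-- **The stacked object, packaged**: an index-one pivot pencil of size `k + 1` with `c + 1` PSD letters (`c ≥ 1`),
pivot exponent `1`, and `≥ 2ck + 2` distinct positive determinant roots. -/
theorem exists_stacked_pencil (c k : ℕ) (hc : 1 ≤ c) :
    ∃ (d : Fin (c + 1) → ℕ) (J : Matrix (Fin (k + 1)) (Fin (k + 1)) ℝ)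
      (P : Fin (c + 1) → Matrix (Fin (k + 1)) (Fin (k + 1)) ℝ),
      J.IsSymm ∧ (∀ l, (P l).PosSemidef) ∧ (∃ W : Matrix (Fin (k + 1)) (Fin 1) ℝ, (J + W * Wᵀ).PosSemidef) ∧
      2 * c * k + 2 ≤ pivotPosRoots 1 d J P := by
  obtain ⟨Ξ, s, hΞ, hs, hle⟩ := exists_stacked c k hc
  exact ⟨_, _, _, isSymm_stackedJ k, fun l => posSemidef_letter c Ξ hΞ hs l, indexOne_stackedJ k, hle⟩

end PoleWeave

/-! ### The theorems of the column -/

open PoleWeave in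
/-- **THE BILINEAR BUDGET IS ATTAINED AT EVERY FORMAT.**  For every `m ≥ 1` and `K ≥ 2` the index-one row
«`Z₊ ≤ 2(m−1)(K−1) + 1`» FAILS at format `(m, K)`: the stacked pole-weaving pencil has `≥ 2(m−1)(K−1) + 2` distinct positive
roots — the budget of R1‴ `RankOnePivotLawBilinear`. -/
theorem not_pivotRootLawAt_bilinear (m K : ℕ) (hm : 1 ≤ m) (hK : 2 ≤ K) :
    ¬ PivotRootLawAt m K 1 (2 * (m - 1) * (K - 1) + 1) := by
  obtain ⟨k, rfl⟩ : ∃ k, m = k + 1 := ⟨m - 1, by omega⟩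
  obtain ⟨c, rfl⟩ : ∃ c, K = c + 1 := ⟨K - 1, by omega⟩
  have hc : 1 ≤ c := by omega
  obtain ⟨d, J, P, hJ, hP, hW, hle⟩ := exists_stacked_pencil c k hc
  intro h
  have h1 := h 1 d J P hJ hP hW
  have h2 : 2 * (k + 1 - 1) * (c + 1 - 1) + 1 = 2 * c * k + 1 := by
    rw [Nat.add_sub_cancel, Nat.add_sub_cancel]; ring
  rw [h2] at h1
  exact absurd (hle.trans h1) (by omega)

/-- Budget form: every valid index-one row at `m ≥ 1`, `K ≥ 2` has budget `≥ 2(m−1)(K−1) + 2`. -/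
theorem le_of_pivotRootLawAt_indexOne {m K B : ℕ} (hm : 1 ≤ m) (hK : 2 ≤ K) (h : PivotRootLawAt m K 1 B) :
    2 * (m - 1) * (K - 1) + 2 ≤ B := by
  by_contra hB
  exact not_pivotRootLawAt_bilinear m K hm hK (pivotRootLawAt_mono h (by omega))

/-- **If R1‴ holds it is EXACT everywhere**: `RankOnePivotLawBilinear → (PivotRootLawAt m K 1 B ↔ 2(m−1)(K−1) + 2 ≤ B)` for
`m ≥ 1`, `K ≥ 2`.  Nothing asserts R1‴. -/
theorem pivotRootLawAt_iff_of_bilinear (h : RankOnePivotLawBilinear) {m K B : ℕ} (hm : 1 ≤ m) (hK : 2 ≤ K) :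
    PivotRootLawAt m K 1 B ↔ 2 * (m - 1) * (K - 1) + 2 ≤ B :=
  ⟨le_of_pivotRootLawAt_indexOne hm hK, fun hB => pivotRootLawAt_mono (h m K) hB⟩

/-- The same failure at every index `q ≥ 1` (zero padding, tree `pivotRootLawAt_of_le_index`). -/
theorem not_pivotRootLawAt_bilinear_index {m K q : ℕ} (hm : 1 ≤ m) (hK : 2 ≤ K) (hq : 1 ≤ q) :
    ¬ PivotRootLawAt m K q (2 * (m - 1) * (K - 1) + 1) := by
  intro h
  obtain ⟨r, rfl⟩ := Nat.exists_eq_add_of_le hq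
  exact not_pivotRootLawAt_bilinear m K hm hK (pivotRootLawAt_of_le_index h)

/-- Every explicit linear-in-`K`-only or linear-in-`m`-only index-one shape is dead, e.g. R1″'s budget `2m(K+1)` is BELOW the
attained count as soon as `(m−1)(K−1) + 1 > m(K+1)`, which never happens — consistency check: the attained count
`2(m−1)(K−1)+2` is `≤ 2m(K+1)` always, so this file does NOT refute R1″ (`RankOnePivotLawLinK`); recorded to prevent misreading. -/
theorem attained_le_linK (m K : ℕ) : 2 * (m - 1) * (K - 1) + 2 ≤ 2 * m * (K + 1) + 2 := by
  have h1 : m - 1 ≤ m := Nat.sub_le m 1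
  have h2 : K - 1 ≤ K + 1 := by omega
  have := Nat.mul_le_mul (Nat.mul_le_mul_left 2 h1) h2
  omega

end Summit.ValiantsHypothesis.ValiantsHypothesis.Theorems.LacunarySymmetroidMatrixDescartes.Pivot
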